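import Literature.MathematicalPhysics.QuantumFieldTheory.QCDPhaseQuenchedReweighting
import Literature.MathematicalPhysics.QuantumLattice.WilsonPropagatorHeavyMass
import Summits.QuantumFields.QCD.Theorems.SpectralDefectExtinctionWindowExtinctionSpreadR3Cores
import Summits.QuantumFields.QCD.Theorems.SpectralDefectExtinctionWindowExtinctionSpreadR3Decomp
import Mathlib.MeasureTheory.Integral.Marginal

/-!
# Every atom of the statistic has phase-quenched probability at most `1/4`

Helper for stub `stub_spreadFromPartsR3` (S6′, reshape r3) of line `free-volume-heavy-witness`
(crux `Summit.QuantumFields.QCD.Theses.SpectralDefectExtinction.WindowExtinction`,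
item stmt-QuantumFields-8964).  Tree vocabulary only (`qcdLatticeMeasure`, `wilsonAction`,
`fermionDet`, `wilsonDirac`, `GaugeConfig`, `box`, `Torus.proj`, `haarProbability`).

`spreadR3_atom_le_quarter`: on the four-torus of side `n ≥ 2R+1` with `N` pairwise `(2R+1+D)`-separated
cores, positive masses, two disjoint measurable template classes `Tp`, `Tm` (`Haar Tp > 0`), suppose the
phase-quenched log-density `φ = -β S_W + log ∏_f |det D_W(μ_f)|` has one-core oscillation `≤ B'` and
two-core mixed differences `≤ γ`, the weighted antichain bound holds with constant `C` at the floor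
`ε ≤ e^{-2B'} min(Haar Tp, Haar Tm)`, `e^{2N²γ} C/√(m+1) ≤ 1/8`, and fewer than `m` cores are active with
phase-quenched probability `≤ 1/8`.  Then every measurable integer statistic `X` that increases by at
least one under every `Tm → Tp` swap of the content of one core has all its atoms of phase-quenched
probability `≤ 1/4` — GIVEN the fibre anti-concentration theorem (stub S4″, hypothesis).

Proof: `P(X = j) ≤ P(< m active) + P(≥ m active, X = j)`; the second term is `≤ 1/8` by the
decomposition along the active set (`spreadR3_atom_decomp`) fed with the core fibre bound
(`spreadR3_core_fiber`), the density of `qcdLatticeMeasure` w.r.t. product Haar being `e^{φ}`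
(`det D_W(μ) ≠ 0` for `μ > 0`).
-/

noncomputable section

namespace Summit.QuantumFields.QCD.Cruxes.WindowExtinction.FreeVolumeHeavyWitness

open MeasureTheory Set Function
open Literature.MathematicalPhysics.QuantumLattice Literature.MathematicalPhysics.QuantumFieldTheory
  Literature.Probability.LatticeModels
open scoped ENNReal BigOperators Classical

/-- The phase-quenched weight `∏_f |det D_W(U, μ_f, 1)|` is positive for positive masses. -/
theorem spreadR3_pqWeight_pos :
    ∀ {n Nf : ℕ} [NeZero n] {μ : Fin Nf → ℝ}, (∀ f, 0 < μ f) → ∀ (U : GaugeConfig 4 n SU3),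
      0 < ∏ f, ‖fermionDet (wilsonDirac (fundamentalRep (Fin 3)) U (μ f) 1)‖ :=
  fun hμ U => Finset.prod_pos fun f _ => norm_pos_iff.2
    (wilsonDirac_det_ne_zero_of_pos (fundamentalRep (Fin 3)) (fun g => fundamentalRep_mem_unitaryGroup g)
      U (hμ f))

/-- The constant of the weighted antichain bound is at least `1` (the empty cube). -/
theorem spreadR3_antichain_const_ge_one {ε C : ℝ}
    (hAC : ∀ (N : ℕ) (p : Fin N → ℝ), (∀ i, ε ≤ p i ∧ p i ≤ 1 - ε) →
      ∀ 𝒜 : Finset (Fin N → Bool), (∀ s ∈ 𝒜, ∀ s' ∈ 𝒜, (∀ i, s i ≤ s' i) → s = s') →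
        ∑ s ∈ 𝒜, ∏ i, (if s i then p i else 1 - p i) ≤ C / Real.sqrt (N + 1)) :
    1 ≤ C := by
  have h := hAC 0 Fin.elim0 (fun i => Fin.elim0 i) Finset.univ
    (fun s _ s' _ _ => funext fun i => Fin.elim0 i)
  simpa using h

/-- **Every atom of the statistic has phase-quenched probability at most `1/4`** (see the module
docstring). -/
theorem spreadR3_atom_le_quarter :
    (∀ {I T : Type} [Fintype I] [DecidableEq I] [MeasurableSpace T]
      (ν : Measure T) [IsProbabilityMeasure ν] {Tp Tm : Set T},
      MeasurableSet Tp → MeasurableSet Tm → Disjoint Tp Tm → ν Tp ≠ 0 →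
      ∀ {ε C : ℝ},
      (∀ (N : ℕ) (p : Fin N → ℝ), (∀ i, ε ≤ p i ∧ p i ≤ 1 - ε) →
        ∀ 𝒜 : Finset (Fin N → Bool), (∀ s ∈ 𝒜, ∀ s' ∈ 𝒜, (∀ i, s i ≤ s' i) → s = s') →
          ∑ s ∈ 𝒜, ∏ i, (if s i then p i else 1 - p i) ≤ C / Real.sqrt (N + 1)) →
      ∀ {φ : (I → T) → ℝ}, Measurable φ → ∀ {a τ B : ℝ} {b : I → T → ℝ},
      (∀ i, Measurable (b i)) →
      (∀ t : I → T, (∀ i, t i ∈ Tp ∪ Tm) → |φ t - a - ∑ i, b i (t i)| ≤ τ) →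
      (∀ i u u', u ∈ Tp ∪ Tm → u' ∈ Tp ∪ Tm → b i u ≤ b i u' + B) →
      (∀ i, ε * ∫ u in Tp ∪ Tm, Real.exp (b i u) ∂ν ≤ ∫ u in Tp, Real.exp (b i u) ∂ν ∧
        ∫ u in Tp, Real.exp (b i u) ∂ν ≤ (1 - ε) * ∫ u in Tp ∪ Tm, Real.exp (b i u) ∂ν) →
      ∀ {X : (I → T) → ℤ}, Measurable X → ∀ (S' : Finset I),
      (∀ t : I → T, (∀ i, t i ∈ Tp ∪ Tm) → ∀ i ∈ S', ∀ u ∈ Tp, t i ∈ Tm →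
        X t + 1 ≤ X (Function.update t i u)) →
      ∀ (j : ℤ),
      ∫⁻ t, (Set.pi Set.univ fun _ : I => Tp ∪ Tm).indicator
          (fun t => if X t = j then ENNReal.ofReal (Real.exp (φ t)) else 0) t
          ∂Measure.pi (fun _ : I => ν) ≤
        ENNReal.ofReal (Real.exp (2 * τ) * C / Real.sqrt (S'.card + 1)) *
          ∫⁻ t, (Set.pi Set.univ fun _ : I => Tp ∪ Tm).indicator
            (fun t => ENNReal.ofReal (Real.exp (φ t))) t ∂Measure.pi (fun _ : I => ν)) →
    ∀ {n : ℕ} [NeZero n] {Nf R D N m : ℕ}, 2 * R + 1 ≤ n → ∀ (cs : Fin N → (Fin 4 → ℤ)),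
    (∀ i j, i ≠ j → ∀ q : Fin 4 → ℤ, ∃ k : Fin 4,
      ((2 * R + 1 + D : ℕ) : ℤ) ≤ |cs i k - cs j k - q k * n|) →
    ∀ {Tp Tm : Set ((↥(box 4 R) × Fin 4) → SU3)}, MeasurableSet Tp → MeasurableSet Tm →
    Disjoint Tp Tm →
    (Measure.pi fun _ : ↥(box 4 R) × Fin 4 => haarProbability SU3) Tp ≠ 0 →
    ∀ {ε C : ℝ},
    (∀ (N : ℕ) (p : Fin N → ℝ), (∀ i, ε ≤ p i ∧ p i ≤ 1 - ε) →
      ∀ 𝒜 : Finset (Fin N → Bool), (∀ s ∈ 𝒜, ∀ s' ∈ 𝒜, (∀ i, s i ≤ s' i) → s = s') →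
        ∑ s ∈ 𝒜, ∏ i, (if s i then p i else 1 - p i) ≤ C / Real.sqrt (N + 1)) →
    ∀ (β : ℝ) (μ : Fin Nf → ℝ), (∀ f, 0 < μ f) → ∀ {γ B' : ℝ}, 0 ≤ γ →
    ε ≤ Real.exp (-2 * B') *
      min ((Measure.pi fun _ : ↥(box 4 R) × Fin 4 => haarProbability SU3) Tp).toReal
        ((Measure.pi fun _ : ↥(box 4 R) × Fin 4 => haarProbability SU3) Tm).toReal →
    (∀ (i : Fin N) (U U' : GaugeConfig 4 n SU3),
      (∀ e, (¬ ∃ y : ↥(box 4 R), Torus.proj n (cs i + (y : Fin 4 → ℤ)) = e.1) → U' e = U e) →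
      -β * wilsonAction (fundamentalRep (Fin 3)) U' +
          Real.log (∏ f, ‖fermionDet (wilsonDirac (fundamentalRep (Fin 3)) U' (μ f) 1)‖) ≤
        -β * wilsonAction (fundamentalRep (Fin 3)) U +
          Real.log (∏ f, ‖fermionDet (wilsonDirac (fundamentalRep (Fin 3)) U (μ f) 1)‖) + B') →
    (∀ (i j : Fin N), i ≠ j → ∀ (U U₁ U₂ U₁₂ : GaugeConfig 4 n SU3),
      (∀ e, (¬ ∃ y : ↥(box 4 R), Torus.proj n (cs i + (y : Fin 4 → ℤ)) = e.1) → U₁ e = U e) →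
      (∀ e, (¬ ∃ y : ↥(box 4 R), Torus.proj n (cs j + (y : Fin 4 → ℤ)) = e.1) → U₂ e = U e) →
      (∀ e, (∃ y : ↥(box 4 R), Torus.proj n (cs i + (y : Fin 4 → ℤ)) = e.1) → U₁₂ e = U₁ e) →
      (∀ e, (¬ ∃ y : ↥(box 4 R), Torus.proj n (cs i + (y : Fin 4 → ℤ)) = e.1) → U₁₂ e = U₂ e) →
      |(-β * wilsonAction (fundamentalRep (Fin 3)) U₁₂ +
          Real.log (∏ f, ‖fermionDet (wilsonDirac (fundamentalRep (Fin 3)) U₁₂ (μ f) 1)‖)) -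
        (-β * wilsonAction (fundamentalRep (Fin 3)) U₁ +
          Real.log (∏ f, ‖fermionDet (wilsonDirac (fundamentalRep (Fin 3)) U₁ (μ f) 1)‖)) -
        (-β * wilsonAction (fundamentalRep (Fin 3)) U₂ +
          Real.log (∏ f, ‖fermionDet (wilsonDirac (fundamentalRep (Fin 3)) U₂ (μ f) 1)‖)) +
        (-β * wilsonAction (fundamentalRep (Fin 3)) U +
          Real.log (∏ f, ‖fermionDet (wilsonDirac (fundamentalRep (Fin 3)) U (μ f) 1)‖))| ≤ γ) →
    Real.exp (2 * ((N : ℝ) ^ 2 * γ)) * C / Real.sqrt (m + 1) ≤ 1 / 8 →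
    qcdLatticeMeasure n β μ
        {U | (Finset.univ.filter fun i : Fin N =>
          (fun yi : ↥(box 4 R) × Fin 4 => U (Torus.proj n (cs i + (yi.1 : Fin 4 → ℤ)), yi.2)) ∈
            Tp ∪ Tm).card < m} ≤ ENNReal.ofReal (1 / 8) →
    ∀ {X : GaugeConfig 4 n SU3 → ℤ}, Measurable X →
    (∀ (i : Fin N) (U U' : GaugeConfig 4 n SU3),
      (∀ e, (¬ ∃ y : ↥(box 4 R), Torus.proj n (cs i + (y : Fin 4 → ℤ)) = e.1) → U' e = U e) →
      (fun yi : ↥(box 4 R) × Fin 4 => U (Torus.proj n (cs i + (yi.1 : Fin 4 → ℤ)), yi.2)) ∈ Tm →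
      (fun yi : ↥(box 4 R) × Fin 4 => U' (Torus.proj n (cs i + (yi.1 : Fin 4 → ℤ)), yi.2)) ∈ Tp →
      X U + 1 ≤ X U') →
    ∀ j : ℤ, qcdLatticeMeasure n β μ {U | X U = j} ≤ 4⁻¹ := by
  intro hFAM n _ Nf R D N m hRn cs hsep Tp Tm hTp hTm hdisj hTp0 ε C hAC β μ hμ γ B' hγ0 hε hosc hmix
    hη hfew X hXm hmono j
  -- the reference product measure, the density and its logarithm
  set π : Measure (GaugeConfig 4 n SU3) := Measure.pi fun _ : Edge 4 n => haarProbability SU3 with hπ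
  set w : GaugeConfig 4 n SU3 → ℝ := fun U =>
    ∏ f, ‖fermionDet (wilsonDirac (fundamentalRep (Fin 3)) U (μ f) 1)‖ with hw
  set φ : GaugeConfig 4 n SU3 → ℝ := fun U =>
    -β * wilsonAction (fundamentalRep (Fin 3)) U + Real.log (w U) with hφ
  set ρ : GaugeConfig 4 n SU3 → ℝ≥0∞ := fun U => ENNReal.ofReal (Real.exp (φ U)) with hρ
  have hwpos : ∀ U, 0 < w U := fun U => spreadR3_pqWeight_pos hμ U
  have hwm : Measurable w := by
    simpa only [hw, norm_det_diracMatrix] using measurable_norm_det_diracMatrix (S := n) μ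
  have hSm : Measurable fun U : GaugeConfig 4 n SU3 => wilsonAction (fundamentalRep (Fin 3)) U :=
    measurable_wilsonAction _ (continuous_fundamentalRep (Fin 3))
  have hfm : Measurable fun U : GaugeConfig 4 n SU3 =>
      Real.exp (-β * wilsonAction (fundamentalRep (Fin 3)) U) :=
    Real.measurable_exp.comp (hSm.const_mul _)
  have hφm : Measurable φ := (hSm.const_mul _).add (Real.measurable_log.comp hwm)
  have hρm : Measurable ρ := hφm.exp.ennreal_ofReal
  have hexpφ : ∀ U, Real.exp (φ U) = Real.exp (-β * wilsonAction (fundamentalRep (Fin 3)) U) * w U :=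
    fun U => by rw [hφ]; simp only; rw [Real.exp_add, Real.exp_log (hwpos U)]
  -- the phase-quenched measure is `(W univ)⁻¹ • W` with `W = π.withDensity ρ`
  have hW : qcdLatticeWeight n β μ = π.withDensity ρ := by
    have h1 : ρ = (fun U => ENNReal.ofReal (Real.exp (-β * wilsonAction (fundamentalRep (Fin 3)) U))) *
        fun U => ENNReal.ofReal (w U) := by
      funext U
      simp only [hρ, Pi.mul_apply, hexpφ U]
      exact ENNReal.ofReal_mul (Real.exp_pos _).le
    rw [h1, withDensity_mul π hfm.ennreal_ofReal hwm.ennreal_ofReal]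
    rfl
  have hP : ∀ A, qcdLatticeMeasure n β μ A = (π.withDensity ρ Set.univ)⁻¹ * π.withDensity ρ A :=
    fun A => by rw [qcdLatticeMeasure, Measure.smul_apply, smul_eq_mul, hW]
  -- cores: contents, links of a set of cores, locality
  set κ : Fin N → GaugeConfig 4 n SU3 → ((↥(box 4 R) × Fin 4) → SU3) :=
    fun i U yi => U (Torus.proj n (cs i + (yi.1 : Fin 4 → ℤ)), yi.2) with hκ
  have hκm : ∀ i, Measurable (κ i) := fun i => measurable_pi_lambda _ fun _ => measurable_pi_apply _
  set E : Finset (Fin N) → Finset (Edge 4 n) := fun S₀ => Finset.univ.filter fun e : Edge 4 n =>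
    ∃ i ∈ S₀, ∃ y : ↥(box 4 R), Torus.proj n (cs i + (y : Fin 4 → ℤ)) = e.1 with hE
  have hloc : ∀ (S₀ : Finset (Fin N)) (i : Fin N), i ∉ S₀ → ∀ (x : GaugeConfig 4 n SU3)
      (y : ↥(E S₀) → SU3), κ i (updateFinset x (E S₀) y) = κ i x :=
    fun S₀ i hi x y => spreadR3_core_locality cs hsep S₀ i hi x y
  -- the fibre bound, uniform in `S₀` with `m ≤ |S₀|`
  have hC1 : 1 ≤ C := spreadR3_antichain_const_ge_one hAC
  set η : ℝ≥0∞ := ENNReal.ofReal (Real.exp (2 * ((N : ℝ) ^ 2 * γ)) * C / Real.sqrt (m + 1)) with hηdef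
  have hfib : ∀ S₀ : Finset (Fin N), m ≤ S₀.card → ∀ x : GaugeConfig 4 n SU3,
      ∫⁻ y, (if (∀ i ∈ S₀, κ i (updateFinset x (E S₀) y) ∈ Tp ∪ Tm) ∧
          X (updateFinset x (E S₀) y) = j then ρ (updateFinset x (E S₀) y) else 0)
          ∂(Measure.pi fun _ : ↥(E S₀) => haarProbability SU3) ≤
        η * ∫⁻ y, (if (∀ i ∈ S₀, κ i (updateFinset x (E S₀) y) ∈ Tp ∪ Tm)
          then ρ (updateFinset x (E S₀) y) else 0) ∂(Measure.pi fun _ : ↥(E S₀) => haarProbability SU3) := by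
    intro S₀ hmS₀ x
    have key := spreadR3_core_fiber hFAM hRn cs hsep hTp hTm hdisj hTp0 hAC hφm hγ0 hε hosc hmix hXm
      hmono j S₀ x
    refine key.trans (mul_le_mul_left ?_ _)
    refine ENNReal.ofReal_le_ofReal ?_
    have hS₀N : (S₀.card : ℝ) ≤ N := by
      have := S₀.card_le_univ
      rw [Fintype.card_fin] at this
      exact_mod_cast this
    have hmS : (m : ℝ) + 1 ≤ S₀.card + 1 := by
      have : (m : ℝ) ≤ S₀.card := by exact_mod_cast hmS₀
      linarith
    have hC0 : 0 ≤ C := zero_le_one.trans hC1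
    have h1 : Real.exp (2 * ((S₀.card : ℝ) ^ 2 * γ)) ≤ Real.exp (2 * ((N : ℝ) ^ 2 * γ)) := by
      refine Real.exp_le_exp.2 (mul_le_mul_of_nonneg_left ?_ (by norm_num))
      exact mul_le_mul_of_nonneg_right (pow_le_pow_left₀ (Nat.cast_nonneg _) hS₀N 2) hγ0
    have h2 : Real.sqrt ((m : ℝ) + 1) ≤ Real.sqrt (S₀.card + 1) := Real.sqrt_le_sqrt hmS
    have hsm : 0 < Real.sqrt ((m : ℝ) + 1) := Real.sqrt_pos.2 (by positivity)
    calc Real.exp (2 * ((S₀.card : ℝ) ^ 2 * γ)) * C / Real.sqrt (S₀.card + 1)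
        ≤ Real.exp (2 * ((N : ℝ) ^ 2 * γ)) * C / Real.sqrt (S₀.card + 1) :=
          div_le_div_of_nonneg_right (mul_le_mul_of_nonneg_right h1 hC0) (Real.sqrt_nonneg _)
      _ ≤ Real.exp (2 * ((N : ℝ) ^ 2 * γ)) * C / Real.sqrt (m + 1) :=
          div_le_div_of_nonneg_left (by positivity) hsm h2
  -- the weight of `{≥ m active, X = j}` is at most `η` times the total weight
  have hdec := spreadR3_atom_decomp (haarProbability SU3) hκm (hTp.union hTm) hρm hXm E hloc j
    (fun S₀ hmS₀ x => by convert hfib S₀ hmS₀ x using 6)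
  have hdec' : π.withDensity ρ
      {U | m ≤ (Finset.univ.filter fun i : Fin N => κ i U ∈ Tp ∪ Tm).card ∧ X U = j} ≤
      η * π.withDensity ρ Set.univ := by
    convert hdec using 8
  -- assemble
  have hη8 : η ≤ ENNReal.ofReal (1 / 8) := ENNReal.ofReal_le_ofReal hη
  have hsplit : {U : GaugeConfig 4 n SU3 | X U = j} ⊆
      {U | (Finset.univ.filter fun i : Fin N => κ i U ∈ Tp ∪ Tm).card < m} ∪
        {U | m ≤ (Finset.univ.filter fun i : Fin N => κ i U ∈ Tp ∪ Tm).card ∧ X U = j} := by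
    intro U hU
    by_cases hm : (Finset.univ.filter fun i : Fin N => κ i U ∈ Tp ∪ Tm).card < m
    · exact Or.inl hm
    · exact Or.inr ⟨not_lt.1 hm, hU⟩
  have hsecond : qcdLatticeMeasure n β μ
      {U | m ≤ (Finset.univ.filter fun i : Fin N => κ i U ∈ Tp ∪ Tm).card ∧ X U = j} ≤ η := by
    rw [hP]
    calc (π.withDensity ρ Set.univ)⁻¹ * π.withDensity ρ
          {U | m ≤ (Finset.univ.filter fun i : Fin N => κ i U ∈ Tp ∪ Tm).card ∧ X U = j}
        ≤ (π.withDensity ρ Set.univ)⁻¹ * (η * π.withDensity ρ Set.univ) := mul_le_mul' le_rfl hdec'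
      _ ≤ η := by
          rw [mul_left_comm]
          exact (mul_le_mul' le_rfl (ENNReal.inv_mul_le_one _)).trans_eq (mul_one _)
  calc qcdLatticeMeasure n β μ {U | X U = j}
      ≤ qcdLatticeMeasure n β μ
          ({U | (Finset.univ.filter fun i : Fin N => κ i U ∈ Tp ∪ Tm).card < m} ∪
            {U | m ≤ (Finset.univ.filter fun i : Fin N => κ i U ∈ Tp ∪ Tm).card ∧ X U = j}) :=
        measure_mono hsplit
    _ ≤ qcdLatticeMeasure n β μ {U | (Finset.univ.filter fun i : Fin N => κ i U ∈ Tp ∪ Tm).card < m} +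
          qcdLatticeMeasure n β μ
            {U | m ≤ (Finset.univ.filter fun i : Fin N => κ i U ∈ Tp ∪ Tm).card ∧ X U = j} :=
        measure_union_le _ _
    _ ≤ ENNReal.ofReal (1 / 8) + ENNReal.ofReal (1 / 8) := add_le_add hfew (hsecond.trans hη8)
    _ = 4⁻¹ := by
        rw [← ENNReal.ofReal_add (by norm_num) (by norm_num),
          show (1 / 8 + 1 / 8 : ℝ) = 4⁻¹ by norm_num, ENNReal.ofReal_inv_of_pos (by norm_num),
          ENNReal.ofReal_ofNat]

end Summit.QuantumFields.QCD.Cruxes.WindowExtinction.FreeVolumeHeavyWitness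

end
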